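import Mathlib
import Summits.Ventures.HodgeRepro.Tier4.Target
import Summits.Ventures.HodgeRepro.Tier4.Line3.Defs
import Summits.Ventures.HodgeRepro.Tier4.Line3.WittSymm
import Summits.Ventures.HodgeRepro.Tier4.Line3.GramCongruence
import Summits.Ventures.HodgeRepro.Tier4.Line3.ConjCongruence
import Summits.Ventures.HodgeRepro.Tier4.Line3.Denominator

/-!
# Tier4/Line3/OffMainOrbit — off the main orbit the Gram matrix differs (rung for L3.4 / L3.5, on `T4Data`)

Blind re-derivation cell `pub-hodge-repro`, Tier 4 «PROVE THE STEP» (README §9–§10), LINE L3 (orbit expansion of the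
quadruple theta period; `Tier4/Line3/Defs.lean` = the skeleton's definitions, t4-L3-p2), seat t4-L2-p3 on L3.5
`term_dominated` (lead S12234).

The landed `WittSymm.witt_symm_of_gram` (field level) is transported here to the skeleton's objects: for the SYMMETRIC
main tuple `xm = (a, b, a, b)` with `a, b` independent, a tuple `x` with `gram x = gram xm` lies in the `U(H)(E′)`-orbit
of `xm` as a LINE tuple — `orbitOf (lines x) = orbitOf (lines xm)` (`orbitOf_eq_of_gram_eq`; the bookkeeping is the
equivalence relation `lineStep` and `Quot.out` of a line).  Hence an OFF-MAIN tuple has a Gram entry different from the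
main one (`exists_gram_ne_of_orbitOf_ne`), and — combined with the two-sided congruence ball of `Loc.supp` (v0.16) through
`GramCongruence.hform_sub_mem_smul` and `ConjCongruence.conjVec_mem_smul_of_involutive` — a Gram DEVIATION that is a
NON-ZERO element of `(𝔭 𝔭̄)^N • gramSpan` (`exists_gram_dev_of_ball`): the input of the archimedean-size rung
`Denominator.rung_archimedean_size_of_mem_smul`.

Complex conjugation of the CM field `E′` is an involution (`IsCMField.complexConj_apply_apply`), which makes the
ring-of-integers map `mapRingHom c` involutive and compatible with `c` — the two side conditions of `ConjCongruence`.

Nothing here asserts anything about the truth of (P); HC_CM is NOT proved by anyone in this repository.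
-/

set_option autoImplicit false

noncomputable section

namespace Summit.Ventures.HodgeRepro.Tier4.Line3

open Matrix NumberField


section DenominatorFinset

variable {R : Type*} [CommRing R] [IsDomain R] {E : Type*} [Field E] [Algebra R E] [IsFractionRing R E]

/-- **A common denominator for finitely many modules.** For a finite family of finitely generated `R`-submodules of the
fraction field there is ONE `D₀ ≠ 0` clearing the denominators of `I • 𝔞 L` for every member `L` and every ideal `I`. -/
theorem exists_denom_finset {ι : Type*} (S : Finset ι) (𝔞 : ι → Submodule R E) (hS : ∀ L ∈ S, (𝔞 L).FG) :
    ∃ D₀ : R, D₀ ≠ 0 ∧ ∀ L ∈ S, ∀ (I : Ideal R) (α : E), α ∈ I • 𝔞 L → ∃ β ∈ I, algebraMap R E β = D₀ • α := by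
  classical
  induction S using Finset.induction_on with
  | empty => exact ⟨1, one_ne_zero, fun L hL => absurd hL (Finset.notMem_empty L)⟩
  | insert L₀ S hL₀ ih =>
    obtain ⟨D₁, hD₁, h₁⟩ := ih fun L hL => hS L (Finset.mem_insert_of_mem hL)
    obtain ⟨D₂, hD₂, h₂⟩ := exists_denom_smul_mem (hS L₀ (Finset.mem_insert_self L₀ S))
    refine ⟨D₁ * D₂, mul_ne_zero hD₁ hD₂, fun L hL I α hα => ?_⟩
    rcases Finset.mem_insert.mp hL with rfl | hL
    · obtain ⟨β, hβ, e⟩ := h₂ I α hα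
      refine ⟨D₁ * β, I.mul_mem_left D₁ hβ, ?_⟩
      rw [map_mul, e]
      simp only [Algebra.smul_def, map_mul]
      ring
    · obtain ⟨β, hβ, e⟩ := h₁ L hL I α hα
      refine ⟨D₂ * β, I.mul_mem_left D₂ hβ, ?_⟩
      rw [map_mul, e]
      simp only [Algebra.smul_def, map_mul]
      ring

end DenominatorFinset

namespace T4Data

variable (X : T4Data)

/-- The conjugation `c′` of `E′` is an involution. -/
theorem c_c (t : X.E) : X.c (X.c t) = t := IsCMField.complexConj_apply_apply X.E t

/-- `c′` on the ring of integers, as a ring endomorphism. -/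
def cR : RingOfIntegers X.E →+* RingOfIntegers X.E := RingOfIntegers.mapRingHom X.c

/-- `cR` is compatible with `c′` through `algebraMap`. -/
theorem algebraMap_cR (r : RingOfIntegers X.E) : algebraMap (RingOfIntegers X.E) X.E (X.cR r) = X.c (algebraMap _ _ r) :=
  rfl

/-- `cR` is an involution. -/
theorem cR_cR (r : RingOfIntegers X.E) : X.cR (X.cR r) = r := by
  apply RingOfIntegers.ext
  simp only [cR, RingOfIntegers.mapRingHom_apply]
  exact X.c_c _

/-- The hermitian form is `c′`-hermitian (the field `hHerm` of `T4Data`, in the skeleton's spelling). -/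
theorem hHerm' : IsCHermitian X.c X.H := X.hHerm

/-- The hermitian form is anisotropic (the field `hAn` of `T4Data`, in the skeleton's spelling). -/
theorem hAn' : Anisotropic X.c X.H := X.hAn

/-! ### `lineStep` is an equivalence relation -/

/-- `lineStep` is reflexive. -/
theorem lineStep_refl (x : Fin 3 → X.E) : X.lineStep x x := ⟨1, by simp, by simp⟩

/-- `lineStep` is symmetric. -/
theorem lineStep_symm {x x' : Fin 3 → X.E} (h : X.lineStep x x') : X.lineStep x' x := by
  obtain ⟨t, ht, rfl⟩ := h
  refine ⟨X.c t, ?_, ?_⟩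
  · rw [X.c_c, mul_comm]
    exact ht
  · rw [smul_smul, ht, one_smul]

/-- `lineStep` is transitive. -/
theorem lineStep_trans {x x' x'' : Fin 3 → X.E} (h : X.lineStep x x') (h' : X.lineStep x' x'') :
    X.lineStep x x'' := by
  obtain ⟨t, ht, rfl⟩ := h
  obtain ⟨t', ht', rfl⟩ := h'
  refine ⟨t' * t, ?_, ?_⟩
  · rw [map_mul]
    calc X.c t' * X.c t * (t' * t) = (X.c t' * t') * (X.c t * t) := by ring
      _ = 1 := by rw [ht, ht', one_mul]
  · rw [smul_smul]

/-- `lineStep` is an equivalence relation. -/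
theorem lineStep_equivalence : Equivalence X.lineStep :=
  ⟨X.lineStep_refl, X.lineStep_symm, X.lineStep_trans⟩

/-- The chosen representative of the line of `x` is a unit-scalar multiple of `x`. -/
theorem lineStep_out (x : Fin 3 → X.E) : X.lineStep x (Quot.out (Quot.mk X.lineStep x)) := by
  have h := Quot.out_eq (Quot.mk X.lineStep x)
  rw [Quot.eq] at h
  exact X.lineStep_symm ((X.lineStep_equivalence).eqvGen_iff.mp h)

/-! ### Equal Gram ⇒ same orbit (symmetric rank-2 main tuple) -/

/-- **EQUAL GRAM MATRIX ⇒ SAME RATIONAL ORBIT** for the symmetric main tuple `xm = (a, b, a, b)`, `a, b` independent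
(the landed `witt_symm_of_gram` on the skeleton's line tuples). -/
theorem orbitOf_eq_of_gram_eq (xm x : X.Tuple) (h02 : xm 2 = xm 0) (h13 : xm 3 = xm 1)
    (hab : LinearIndependent X.E ![xm 0, xm 1]) (hG : X.gram x = X.gram xm) :
    X.orbitOf (X.lines x) = X.orbitOf (X.lines xm) := by
  have hxm : ∀ j, ![xm 0, xm 1, xm 0, xm 1] j = xm j := by
    intro j
    fin_cases j <;> simp [h02, h13]
  have hG' : ∀ i j, hform X.c X.H (x i) (x j) =
      hform X.c X.H (![xm 0, xm 1, xm 0, xm 1] i) (![xm 0, xm 1, xm 0, xm 1] j) := by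
    intro i j
    rw [hxm i, hxm j]
    exact congrFun (congrFun hG i) j
  obtain ⟨g, hg, hgx⟩ := witt_symm_of_gram X.c X.H X.hAn' X.hHerm' X.c_c (xm 0) (xm 1) hab x hG'
  have hx : ∀ j, x j = g *ᵥ xm j := by
    intro j
    rw [hgx j, hxm j]
  symm
  apply Quot.sound
  refine ⟨g, hg, fun j => ?_⟩
  -- `Quot.out (lines xm j) = t • xm j`; `g (t • xm j) = t • x j`, and `t • x j` spans the same line as `x j`
  obtain ⟨t, ht, hout⟩ := X.lineStep_out (xm j)
  show Quot.mk X.lineStep (x j) = Quot.mk X.lineStep (g *ᵥ Quot.out (Quot.mk X.lineStep (xm j)))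
  rw [hout, Matrix.mulVec_smul, ← hx j]
  apply Quot.sound
  exact ⟨t, ht, rfl⟩

/-- **OFF THE MAIN ORBIT, SOME GRAM ENTRY DIFFERS.** -/
theorem exists_gram_ne_of_orbitOf_ne (xm x : X.Tuple) (h02 : xm 2 = xm 0) (h13 : xm 3 = xm 1)
    (hab : LinearIndependent X.E ![xm 0, xm 1]) (hne : X.orbitOf (X.lines x) ≠ X.orbitOf (X.lines xm)) :
    ∃ i j, X.gram x i j - X.gram xm i j ≠ 0 := by
  by_contra hall
  apply hne
  apply X.orbitOf_eq_of_gram_eq xm x h02 h13 hab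
  ext i j
  by_contra h
  exact hall ⟨i, j, sub_ne_zero.mpr h⟩

/-! ### The Gram deviation of an off-main tuple in the two-sided ball -/

/-- The two-sided depth-`N` ideal `(𝔭 𝔭̄)^N`, with `𝔭̄ = map cR 𝔭` (the skeleton's `conjIdeal`, v0.16). -/
def ballIdeal (p : IsDedekindDomain.HeightOneSpectrum (RingOfIntegers X.E)) (N : ℕ) : Ideal (RingOfIntegers X.E) :=
  (p.asIdeal * Ideal.map X.cR p.asIdeal) ^ N

/-- The Gram span attached to a lattice `L` of the support and the main tuple (`GramCongruence.gramSpan` with the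
conjugate lattice of `L`). -/
def gramSpanL (L : Submodule (RingOfIntegers X.E) (Fin 3 → X.E)) (xm : X.Tuple) : Submodule (RingOfIntegers X.E) X.E :=
  gramSpan X.c X.H (RingOfIntegers X.E) L (conjLattice X.c L) xm

/-- The Gram span of a finitely generated lattice is finitely generated. -/
theorem gramSpanL_fg {L : Submodule (RingOfIntegers X.E) (Fin 3 → X.E)} (hL : L.FG) (xm : X.Tuple) :
    (X.gramSpanL L xm).FG :=
  gramSpan_fg X.c X.H _ hL (conjLattice_fg X.c X.cR X.algebraMap_cR hL) xm

/-- **THE GRAM DEVIATION OF AN OFF-MAIN TUPLE IN THE BALL.** For the symmetric main tuple `xm`, a tuple `x` in the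
two-sided depth-`N` ball `x j − xm j ∈ (𝔭 𝔭̄)^N • L` whose line tuple is OFF the main orbit has a Gram entry deviating
from the main one by a NON-ZERO element of `(𝔭 𝔭̄)^N • gramSpanL L xm`. -/
theorem exists_gram_dev_of_ball (p : IsDedekindDomain.HeightOneSpectrum (RingOfIntegers X.E)) (N : ℕ)
    (L : Submodule (RingOfIntegers X.E) (Fin 3 → X.E)) (xm x : X.Tuple) (h02 : xm 2 = xm 0) (h13 : xm 3 = xm 1)
    (hab : LinearIndependent X.E ![xm 0, xm 1]) (hne : X.orbitOf (X.lines x) ≠ X.orbitOf (X.lines xm))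
    (hx : ∀ j, x j - xm j ∈ X.ballIdeal p N • L) :
    ∃ i j, X.gram x i j - X.gram xm i j ≠ 0 ∧ X.gram x i j - X.gram xm i j ∈ X.ballIdeal p N • X.gramSpanL L xm := by
  obtain ⟨i, j, hij⟩ := X.exists_gram_ne_of_orbitOf_ne xm x h02 h13 hab hne
  refine ⟨i, j, hij, ?_⟩
  have hcx : ∀ j, conjVec X.c (x j - xm j) ∈ X.ballIdeal p N • conjLattice X.c L := fun j =>
    conjVec_mem_smul_of_involutive X.c X.cR X.algebraMap_cR X.cR_cR p.asIdeal N L (hx j)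
  exact hform_sub_mem_smul X.c X.H (RingOfIntegers X.E) (X.ballIdeal p N) L (conjLattice X.c L) xm x hx hcx i j

/-- `(𝔭 𝔭̄)^N ≤ 𝔭^N`. -/
theorem ballIdeal_le (p : IsDedekindDomain.HeightOneSpectrum (RingOfIntegers X.E)) (N : ℕ) :
    X.ballIdeal p N ≤ p.asIdeal ^ N := by
  unfold ballIdeal
  exact Ideal.pow_right_mono Ideal.mul_le_right N

/-- **THE ARCHIMEDEAN SIZE OF THE GRAM DEVIATION, UNIFORMLY IN THE DEPTH.** For a finite set `S` of finitely generated
lattices there is one `D₀ ≠ 0` such that, at EVERY depth `N`, every tuple `x` of the two-sided ball `x ≡ xm mod (𝔭 𝔭̄)^N L`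
(`L ∈ S`) whose line tuple is off the main orbit has a Gram entry `i j` with
`N(𝔭)^N ≤ ‖σ D₀‖^d · ‖σ (⟨x i, x j⟩ − ⟨xm i, xm j⟩)‖^d` at some embedding `σ` (`d = [E′ : ℚ]`). -/
theorem exists_gram_dev_size (p : IsDedekindDomain.HeightOneSpectrum (RingOfIntegers X.E))
    (S : Finset (Submodule (RingOfIntegers X.E) (Fin 3 → X.E))) (hS : ∀ L ∈ S, L.FG) (xm : X.Tuple)
    (h02 : xm 2 = xm 0) (h13 : xm 3 = xm 1) (hab : LinearIndependent X.E ![xm 0, xm 1]) :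
    ∃ D₀ : RingOfIntegers X.E, D₀ ≠ 0 ∧ ∀ (N : ℕ) (x : X.Tuple) (L : Submodule (RingOfIntegers X.E) (Fin 3 → X.E)),
      L ∈ S → (∀ j, x j - xm j ∈ X.ballIdeal p N • L) → X.orbitOf (X.lines x) ≠ X.orbitOf (X.lines xm) →
      ∃ (i j : Fin 4) (σ : X.E →+* ℂ), ((Ideal.absNorm p.asIdeal : ℝ) ^ N) ≤
        ‖σ D₀‖ ^ Module.finrank ℚ X.E * ‖σ (X.gram x i j - X.gram xm i j)‖ ^ Module.finrank ℚ X.E := by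
  obtain ⟨D₀, hD₀, hden⟩ := exists_denom_finset S (fun L => X.gramSpanL L xm) fun L hL => X.gramSpanL_fg (hS L hL) xm
  refine ⟨D₀, hD₀, fun N x L hL hx hne => ?_⟩
  obtain ⟨i, j, hij, hmem⟩ := X.exists_gram_dev_of_ball p N L xm x h02 h13 hab hne hx
  have hmem' : X.gram x i j - X.gram xm i j ∈ p.asIdeal ^ N • X.gramSpanL L xm :=
    Submodule.smul_mono_left (X.ballIdeal_le p N) hmem
  obtain ⟨σ, hσ⟩ := rung_archimedean_size_of_mem_smul X.E p N hD₀ (hden L hL) hmem' hij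
  exact ⟨i, j, σ, hσ⟩

end T4Data

end Summit.Ventures.HodgeRepro.Tier4.Line3

end
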